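import Literature.InformationTheory.QuantumCodes.CSSPhenomenologicalThreshold
import Literature.InformationTheory.QuantumCodes.CSSEquivalence
import HarnessLib

/-!
# The space-time (phenomenological) decoding problem is invariant under re-indexing qubits and checks

Topic `Literature/InformationTheory/QuantumCodes` (venture QEC, LADDER-QEC rung Q5, PARTITION row 09 "phenomenological";
qec-type-09 gen 5). `CSSPhenomenologicalThreshold.lean` (qec-lit-2) types the `T`-round memory experiment of one sector of a
CSS code with parity-check matrix `H : Matrix ι V (ZMod 2)` and trivial set `SX ⊆ (V → ZMod 2)`: space-time boundary matrix
`stMatrix H T`, record `stSyn H T`, cycles `stCycles H T`, harmless histories `stTrivial SX T`, space-time decoders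
`STDecoder ι V T` and the two-rate failure probability `phenomFailureProb H T SX D p q`. `CSSEquivalenceNoise.lean` (qec-lit-2)
proves that the CODE-CAPACITY failure probability is invariant under a simultaneous re-indexing of checks and qubits
(`CSSCode.zFailure_reindex`, transported decoder `s' ↦ D(s' ∘ eX) ∘ eQ⁻¹`; Lin–Pryadko's permutation equivalence, Thm 6).
This file is the SPACE-TIME twin, PROVED, elementary, no named fact: for equivalences `eC : ι ≃ ι'` (checks) and
`eQ : V ≃ V'` (qubits), the re-indexed matrix `Matrix.reindex eC eQ H` has

* space-time boundary matrix = the re-indexed one (`stMatrix_reindex`), along the induced equivalences of fault locations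
  `HistoryLoc V ι T ≃ HistoryLoc V' ι' T` (`Equiv.sumCongr (eQ × 1) (eC × 1)`) and of space-time checks `(eC × 1)`;
* records, cycles, projections and harmless sets corresponding along these equivalences (`stSyn_comp_locEquiv`,
  `proj_comp_locEquiv`, `mem_stTrivial_comp_iff`);
* for every space-time decoder `D'` of the re-indexed problem, the PULLED-BACK decoder `s ↦ D'(s ∘ (eC × 1)⁻¹) ∘ (eQ × 1 ⊕ eC × 1)`
  of the original problem corrects `E' ∘ (⋯)` iff `D'` corrects `E'` (`corrects_pullback_iff`), is minimum-weight iff `D'` is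
  (`isMinWeight_pullback`), and has THE SAME two-rate failure probability at every `(p, q)` (`phenomFailureProb_pullback`:
  the phenomenological law is invariant, `phenomenologicalWeight_comp_locEquiv`).

Consequence (Summits side, `Thresholds/ToricCodeXSectorPhenomenologicalDual.lean`): with qec-lit-2's
`ToricCode.toricCode_swap_eq_reindex` (the `X ↔ Z` exchange of the lattice toric code is a re-indexing along the lattice
duality) every `Z`-sector phenomenological threshold theorem valid for all minimum-weight space-time decoder families
transfers verbatim to the `X` sector (noisy PLAQUETTE record). Everything here is stated for an arbitrary matrix `H`, so
the same transfer serves any CSS family with a check/qubit symmetry (planar codes, two-block codes).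

## References

* [DennisEtAl2002] E. Dennis, A. Kitaev, A. Landahl, J. Preskill, *Topological quantum memory*, J. Math. Phys. 43 (2002)
  4452–4505, arXiv:quant-ph/0110143, §4.1 ("we may treat X errors and Z errors separately" — identically, on the dual
  lattice), §4.2–4.3 (the space-time model), §5.2 (Prob_fail).
* [LinPryadko2024] H.-K. Lin, L. P. Pryadko, *Quantum two-block group algebra codes*, Phys. Rev. A 109 (2024) 022407,
  arXiv:2306.16400, §4.2 Thm 6 (permutation-equivalent codes have identical parameters).
-/

namespace Literature.InformationTheory.QuantumCodes

open Finset Matrix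

namespace CSSPhenom

variable {ι V ι' V' : Type*} {T : ℕ}

/-! ### The space-time boundary matrix of a re-indexed check matrix -/

/-- **`stMatrix (reindex eC eQ H) T` is `stMatrix H T` re-indexed** along the space-time checks `(eC × 1)` and the fault
locations `(eQ × 1) ⊕ (eC × 1)`. [cite: DennisEtAl2002, §4.2–4.3 (the space-time lattice is built from the code lattice)] -/
theorem stMatrix_reindex [DecidableEq ι] [DecidableEq ι'] (H : Matrix ι V (ZMod 2)) (eC : ι ≃ ι') (eQ : V ≃ V')
    (T : ℕ) :
    stMatrix (Matrix.reindex eC eQ H) T =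
      Matrix.reindex (eC.prodCongr (Equiv.refl (Fin (T + 1))))
        (Equiv.sumCongr (eQ.prodCongr (Equiv.refl (Fin T))) (eC.prodCongr (Equiv.refl (Fin T))))
        (stMatrix H T) := by
  ext ⟨c', τ⟩ ℓ'
  rcases ℓ' with ⟨v', t⟩ | ⟨d', t⟩
  · simp [stMatrix, Matrix.reindex_apply]
  · simp [stMatrix, Matrix.reindex_apply]

/-- **Records correspond**: the record of `E'` for the re-indexed matrix, read at the re-indexed checks, is the record of
the pulled-back history `E' ∘ ((eQ × 1) ⊕ (eC × 1))` for `H`. [cite: DennisEtAl2002, §4.3 (∂S = ∂E)] -/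
theorem stSyn_comp_locEquiv [Fintype ι] [Fintype ι'] [DecidableEq ι] [DecidableEq ι'] [Fintype V] [Fintype V']
    (H : Matrix ι V (ZMod 2)) (eC : ι ≃ ι') (eQ : V ≃ V') (E' : History ι' V' T) :
    stSyn H T (E' ∘ ⇑(Equiv.sumCongr (eQ.prodCongr (Equiv.refl (Fin T))) (eC.prodCongr (Equiv.refl (Fin T))))) =
      stSyn (Matrix.reindex eC eQ H) T E' ∘ ⇑(eC.prodCongr (Equiv.refl (Fin (T + 1)))) := by
  unfold stSyn
  rw [stMatrix_reindex, Matrix.reindex_apply, Matrix.submatrix_mulVec_equiv]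
  funext x
  simp only [Function.comp_apply, Equiv.symm_symm, Equiv.symm_apply_apply]

/-- The same with the history written on the original locations: the record of `E ∘ ((eQ × 1) ⊕ (eC × 1))⁻¹` for the
re-indexed matrix is the record of `E`, read at `(eC × 1)⁻¹`. [cite: DennisEtAl2002, §4.3 (∂S = ∂E)] -/
theorem stSyn_reindex_comp_symm [Fintype ι] [Fintype ι'] [DecidableEq ι] [DecidableEq ι'] [Fintype V] [Fintype V']
    (H : Matrix ι V (ZMod 2)) (eC : ι ≃ ι') (eQ : V ≃ V') (E : History ι V T) :
    stSyn (Matrix.reindex eC eQ H) T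
        (E ∘ ⇑(Equiv.sumCongr (eQ.prodCongr (Equiv.refl (Fin T))) (eC.prodCongr (Equiv.refl (Fin T)))).symm) =
      stSyn H T E ∘ ⇑(eC.prodCongr (Equiv.refl (Fin (T + 1)))).symm := by
  have h := stSyn_comp_locEquiv (T := T) H eC eQ
    (E ∘ ⇑(Equiv.sumCongr (eQ.prodCongr (Equiv.refl (Fin T))) (eC.prodCongr (Equiv.refl (Fin T)))).symm)
  have hE : (E ∘ ⇑(Equiv.sumCongr (eQ.prodCongr (Equiv.refl (Fin T))) (eC.prodCongr (Equiv.refl (Fin T)))).symm) ∘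
      ⇑(Equiv.sumCongr (eQ.prodCongr (Equiv.refl (Fin T))) (eC.prodCongr (Equiv.refl (Fin T)))) = E := by
    funext ℓ
    simp only [Function.comp_apply, Equiv.symm_apply_apply]
  rw [hE] at h
  rw [h]
  funext x
  simp only [Function.comp_apply, Equiv.apply_symm_apply]

/-- **Cycles correspond**: `E'` is a space-time cycle of the re-indexed matrix iff its pull-back is one of `H`.
[cite: DennisEtAl2002, §4.3 (cycles)] -/
theorem comp_locEquiv_mem_stCycles_iff [Fintype ι] [Fintype ι'] [DecidableEq ι] [DecidableEq ι'] [Fintype V]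
    [Fintype V'] (H : Matrix ι V (ZMod 2)) (eC : ι ≃ ι') (eQ : V ≃ V') (E' : History ι' V' T) :
    E' ∘ ⇑(Equiv.sumCongr (eQ.prodCongr (Equiv.refl (Fin T))) (eC.prodCongr (Equiv.refl (Fin T)))) ∈ stCycles H T ↔
      E' ∈ stCycles (Matrix.reindex eC eQ H) T := by
  change stSyn H T _ = 0 ↔ stSyn (Matrix.reindex eC eQ H) T E' = 0
  rw [stSyn_comp_locEquiv]
  constructor
  · intro h
    funext x'
    have := congrFun h ((eC.prodCongr (Equiv.refl (Fin (T + 1)))).symm x')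
    simpa only [Function.comp_apply, Equiv.apply_symm_apply, Pi.zero_apply] using this
  · intro h
    rw [h]
    rfl

/-- **Projections correspond**: the net qubit error of the pulled-back history is the pulled-back net error,
`Π(E' ∘ (⋯)) = Π(E') ∘ eQ`. [cite: DennisEtAl2002, §6.1 (the projected chain Π)] -/
theorem proj_comp_locEquiv [Fintype V] [Fintype V'] (eC : ι ≃ ι') (eQ : V ≃ V') (E' : History ι' V' T) :
    proj (E' ∘ ⇑(Equiv.sumCongr (eQ.prodCongr (Equiv.refl (Fin T))) (eC.prodCongr (Equiv.refl (Fin T))))) =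
      proj E' ∘ ⇑eQ := by
  funext v
  simp [proj_apply]

/-- **Harmless sets correspond**: if `SX'` is the transported trivial set (`x ∈ SX' ↔ x ∘ eQ ∈ SX`, e.g. the row space of a
re-indexed matrix, `mem_rowSpace_reindex_iff`), then `E' ∘ (⋯)` is harmless for `SX` iff `E'` is harmless for `SX'`.
[cite: DennisEtAl2002, §4.3 (success iff E + E' is homologically trivial)] -/
theorem mem_stTrivial_comp_iff [Fintype V] [Fintype V'] (eC : ι ≃ ι') (eQ : V ≃ V') {SX : Set (V → ZMod 2)}
    {SX' : Set (V' → ZMod 2)} (hS : ∀ x, x ∈ SX' ↔ x ∘ ⇑eQ ∈ SX) (E' : History ι' V' T) :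
    E' ∘ ⇑(Equiv.sumCongr (eQ.prodCongr (Equiv.refl (Fin T))) (eC.prodCongr (Equiv.refl (Fin T)))) ∈
        stTrivial (ι := ι) SX T ↔
      E' ∈ stTrivial (ι := ι') SX' T := by
  change proj _ ∈ SX ↔ proj E' ∈ SX'
  rw [proj_comp_locEquiv, hS]

/-! ### Pulled-back decoders -/

/-- **Pulled-back decoders correct corresponding histories**: the decoder `s ↦ D'(s ∘ (eC × 1)⁻¹) ∘ ((eQ × 1) ⊕ (eC × 1))`
of the original problem corrects `E' ∘ (⋯)` iff `D'` corrects `E'` (re-indexed matrix, transported trivial set).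
[cite: LinPryadko2024, §4.2 Thm 6 (permutation equivalence)] [cite: DennisEtAl2002, §4.3 (success criterion)] -/
theorem corrects_pullback_iff [Fintype ι] [Fintype ι'] [DecidableEq ι] [DecidableEq ι'] [Fintype V] [Fintype V']
    (H : Matrix ι V (ZMod 2)) (eC : ι ≃ ι') (eQ : V ≃ V') {SX : Set (V → ZMod 2)} {SX' : Set (V' → ZMod 2)}
    (hS : ∀ x, x ∈ SX' ↔ x ∘ ⇑eQ ∈ SX) (D' : STDecoder ι' V' T) (E' : History ι' V' T) :
    Decoder.Corrects
        (fun s : STSyndrome ι T =>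
          D' (s ∘ ⇑(eC.prodCongr (Equiv.refl (Fin (T + 1)))).symm) ∘
            ⇑(Equiv.sumCongr (eQ.prodCongr (Equiv.refl (Fin T))) (eC.prodCongr (Equiv.refl (Fin T)))))
        (stSyn H T) (stTrivial SX T)
        (E' ∘ ⇑(Equiv.sumCongr (eQ.prodCongr (Equiv.refl (Fin T))) (eC.prodCongr (Equiv.refl (Fin T))))) ↔
      D'.Corrects (stSyn (Matrix.reindex eC eQ H) T) (stTrivial SX' T) E' := by
  rw [Decoder.corrects_iff, Decoder.corrects_iff, stSyn_comp_locEquiv]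
  have hsyn : (stSyn (Matrix.reindex eC eQ H) T E' ∘ ⇑(eC.prodCongr (Equiv.refl (Fin (T + 1))))) ∘
      ⇑(eC.prodCongr (Equiv.refl (Fin (T + 1)))).symm = stSyn (Matrix.reindex eC eQ H) T E' := by
    funext x
    simp only [Function.comp_apply, Equiv.apply_symm_apply]
  rw [hsyn]
  have hsum : D' (stSyn (Matrix.reindex eC eQ H) T E') ∘
        ⇑(Equiv.sumCongr (eQ.prodCongr (Equiv.refl (Fin T))) (eC.prodCongr (Equiv.refl (Fin T)))) +
      E' ∘ ⇑(Equiv.sumCongr (eQ.prodCongr (Equiv.refl (Fin T))) (eC.prodCongr (Equiv.refl (Fin T)))) =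
      (D' (stSyn (Matrix.reindex eC eQ H) T E') + E') ∘
        ⇑(Equiv.sumCongr (eQ.prodCongr (Equiv.refl (Fin T))) (eC.prodCongr (Equiv.refl (Fin T)))) := by
    funext ℓ
    simp only [Pi.add_apply, Function.comp_apply]
  rw [hsum, mem_stTrivial_comp_iff eC eQ hS]

/-- **Minimum weight is preserved by pull-back**: if `D'` is a minimum-weight space-time decoder of the re-indexed
problem (record `stSyn (reindex eC eQ H) T`, cycles, number of faulty locations), its pull-back is a minimum-weight
space-time decoder of the original problem. [cite: DennisEtAl2002, §5.1 eq. (E_min) (on the lattice and on the dual lattice alike)] -/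
theorem isMinWeight_pullback [Fintype ι] [Fintype ι'] [DecidableEq ι] [DecidableEq ι'] [Fintype V] [Fintype V']
    [DecidableEq V] [DecidableEq V'] (H : Matrix ι V (ZMod 2)) (eC : ι ≃ ι') (eQ : V ≃ V') {D' : STDecoder ι' V' T}
    (hD' : D'.IsMinWeight (stSyn (Matrix.reindex eC eQ H) T) (stCycles (Matrix.reindex eC eQ H) T) hammingNorm) :
    Decoder.IsMinWeight
      (fun s : STSyndrome ι T =>
        D' (s ∘ ⇑(eC.prodCongr (Equiv.refl (Fin (T + 1)))).symm) ∘
          ⇑(Equiv.sumCongr (eQ.prodCongr (Equiv.refl (Fin T))) (eC.prodCongr (Equiv.refl (Fin T)))))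
      (stSyn H T) (stCycles H T) hammingNorm := by
  refine ⟨fun E => ?_, fun E => ?_⟩
  · -- write `E = E' ∘ locEquiv` with `E' := E ∘ locEquiv⁻¹`
    have hsyn := stSyn_reindex_comp_symm (T := T) H eC eQ E
    have hE : E = (E ∘ ⇑(Equiv.sumCongr (eQ.prodCongr (Equiv.refl (Fin T))) (eC.prodCongr (Equiv.refl (Fin T)))).symm) ∘
        ⇑(Equiv.sumCongr (eQ.prodCongr (Equiv.refl (Fin T))) (eC.prodCongr (Equiv.refl (Fin T)))) := by
      funext ℓ
      simp only [Function.comp_apply, Equiv.symm_apply_apply]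
    have hadd := hD'.add_mem
      (E ∘ ⇑(Equiv.sumCongr (eQ.prodCongr (Equiv.refl (Fin T))) (eC.prodCongr (Equiv.refl (Fin T)))).symm)
    rw [hsyn] at hadd
    rw [← comp_locEquiv_mem_stCycles_iff H eC eQ] at hadd
    have hrw : (D' (stSyn H T E ∘ ⇑(eC.prodCongr (Equiv.refl (Fin (T + 1)))).symm) +
          E ∘ ⇑(Equiv.sumCongr (eQ.prodCongr (Equiv.refl (Fin T))) (eC.prodCongr (Equiv.refl (Fin T)))).symm) ∘
        ⇑(Equiv.sumCongr (eQ.prodCongr (Equiv.refl (Fin T))) (eC.prodCongr (Equiv.refl (Fin T)))) =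
        D' (stSyn H T E ∘ ⇑(eC.prodCongr (Equiv.refl (Fin (T + 1)))).symm) ∘
            ⇑(Equiv.sumCongr (eQ.prodCongr (Equiv.refl (Fin T))) (eC.prodCongr (Equiv.refl (Fin T)))) + E := by
      funext ℓ
      simp only [Pi.add_apply, Function.comp_apply, Equiv.symm_apply_apply]
    rwa [hrw] at hadd
  · have hsyn := stSyn_reindex_comp_symm (T := T) H eC eQ E
    have hle := hD'.weight_le
      (E ∘ ⇑(Equiv.sumCongr (eQ.prodCongr (Equiv.refl (Fin T))) (eC.prodCongr (Equiv.refl (Fin T)))).symm)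
    rw [hsyn, hammingNorm_comp_equiv] at hle
    have hnorm : hammingNorm (D' (stSyn H T E ∘ ⇑(eC.prodCongr (Equiv.refl (Fin (T + 1)))).symm) ∘
        ⇑(Equiv.sumCongr (eQ.prodCongr (Equiv.refl (Fin T))) (eC.prodCongr (Equiv.refl (Fin T))))) =
        hammingNorm (D' (stSyn H T E ∘ ⇑(eC.prodCongr (Equiv.refl (Fin (T + 1)))).symm)) := by
      have := hammingNorm_comp_equiv (D' (stSyn H T E ∘ ⇑(eC.prodCongr (Equiv.refl (Fin (T + 1)))).symm))
        (Equiv.sumCongr (eQ.prodCongr (Equiv.refl (Fin T))) (eC.prodCongr (Equiv.refl (Fin T)))).symm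
      rwa [Equiv.symm_symm] at this
    rw [hnorm]
    exact hle

/-- Every decoder of the re-indexed problem IS the push-forward of its pull-back:
`D' = s' ↦ (pullback D')(s' ∘ (eC × 1)) ∘ ((eQ × 1) ⊕ (eC × 1))⁻¹` (so statements about all decoders on one side are
statements about all decoders on the other). [cite: LinPryadko2024, §4.2 Thm 6 (permutation equivalence is an equivalence)] -/
theorem pushforward_pullback (eC : ι ≃ ι') (eQ : V ≃ V') (D' : STDecoder ι' V' T) :
    (fun s' : STSyndrome ι' T =>
      (fun s : STSyndrome ι T =>
          D' (s ∘ ⇑(eC.prodCongr (Equiv.refl (Fin (T + 1)))).symm) ∘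
            ⇑(Equiv.sumCongr (eQ.prodCongr (Equiv.refl (Fin T))) (eC.prodCongr (Equiv.refl (Fin T)))))
          (s' ∘ ⇑(eC.prodCongr (Equiv.refl (Fin (T + 1))))) ∘
        ⇑(Equiv.sumCongr (eQ.prodCongr (Equiv.refl (Fin T))) (eC.prodCongr (Equiv.refl (Fin T)))).symm) = D' := by
  funext s' ℓ'
  have hs : (s' ∘ ⇑(eC.prodCongr (Equiv.refl (Fin (T + 1))))) ∘ ⇑(eC.prodCongr (Equiv.refl (Fin (T + 1)))).symm = s' := by
    funext x
    simp only [Function.comp_apply, Equiv.apply_symm_apply]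
  simp only [Function.comp_apply, hs, Equiv.apply_symm_apply]

/-! ### The phenomenological law is invariant -/

/-- The independent weight is invariant under re-indexing the locations (rates transported along the equivalence).
[cite: DennisEtAl2002, §4.4 eq. (prob_E)] -/
theorem indepWeight_map_equiv {α β : Type*} [Fintype α] [Fintype β] [DecidableEq α] [DecidableEq β] (e : α ≃ β)
    (r : β → ℝ) (E : Finset β) : indepWeight (r ∘ ⇑e) (E.map e.symm.toEmbedding) = indepWeight r E := by
  unfold indepWeight
  congr 1
  · exact Finset.prod_equiv e (fun i => by simp [Finset.mem_map_equiv]) (fun i _ => rfl)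
  · exact Finset.prod_equiv e (fun i => by simp [Finset.mem_map_equiv]) (fun i _ => rfl)

/-- Support of a pulled-back vector: `supp (x ∘ e) = e⁻¹(supp x)`. [cite: LinPryadko2024, App. proof of Thm 6(i)] -/
theorem supp_comp_equiv {α β : Type*} [Fintype α] [Fintype β] [DecidableEq α] [DecidableEq β] (e : α ≃ β)
    (x : β → ZMod 2) : supp (x ∘ ⇑e) = (supp x).map e.symm.toEmbedding := by
  ext a
  simp [supp, Finset.mem_map_equiv]

/-- **The phenomenological law is invariant**: the pulled-back history `E' ∘ ((eQ × 1) ⊕ (eC × 1))` has the same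
probability as `E'` (qubit locations go to qubit locations, measurement locations to measurement locations).
[cite: DennisEtAl2002, §5.1 eq. (HV_prob) (the law depends only on the numbers H, V of faulty links of each kind)] -/
theorem phenomenologicalWeight_comp_locEquiv [Fintype ι] [Fintype ι'] [DecidableEq ι] [DecidableEq ι'] [Fintype V]
    [Fintype V'] [DecidableEq V] [DecidableEq V'] (eC : ι ≃ ι') (eQ : V ≃ V') (E' : History ι' V' T) (p q : ℝ) :
    phenomenologicalWeight T p q
        (supp (E' ∘ ⇑(Equiv.sumCongr (eQ.prodCongr (Equiv.refl (Fin T))) (eC.prodCongr (Equiv.refl (Fin T)))))) =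
      phenomenologicalWeight T p q (supp E') := by
  unfold phenomenologicalWeight
  rw [supp_comp_equiv, ← indepWeight_map_equiv
    (Equiv.sumCongr (eQ.prodCongr (Equiv.refl (Fin T))) (eC.prodCongr (Equiv.refl (Fin T)))) (phenomRate p q) (supp E')]
  congr 1
  funext ℓ
  rcases ℓ with ⟨v, t⟩ | ⟨c, t⟩
  · simp [phenomRate]
  · simp [phenomRate]

open Classical in
/-- **The two-rate failure probability is a re-indexing invariant**: for every space-time decoder `D'` of the re-indexed
problem `(reindex eC eQ H, SX')` and every `(p, q)`, `Prob_fail(D') = Prob_fail(pullback D')` for the original problem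
`(H, SX)` — reindex the failure sum along `E' ↦ E' ∘ ((eQ × 1) ⊕ (eC × 1))`.
[cite: LinPryadko2024, §4.2 Thm 6 (permutation-equivalent codes)] [cite: DennisEtAl2002, §5.2 (Prob_fail)] -/
theorem phenomFailureProb_pullback [Fintype ι] [Fintype ι'] [DecidableEq ι] [DecidableEq ι'] [Fintype V] [Fintype V']
    [DecidableEq V] [DecidableEq V'] (H : Matrix ι V (ZMod 2)) (eC : ι ≃ ι') (eQ : V ≃ V') (T : ℕ)
    {SX : Set (V → ZMod 2)} {SX' : Set (V' → ZMod 2)} (hS : ∀ x, x ∈ SX' ↔ x ∘ ⇑eQ ∈ SX) (D' : STDecoder ι' V' T)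
    (p q : ℝ) :
    phenomFailureProb (Matrix.reindex eC eQ H) T SX' D' p q =
      phenomFailureProb H T SX
        (fun s : STSyndrome ι T =>
          D' (s ∘ ⇑(eC.prodCongr (Equiv.refl (Fin (T + 1)))).symm) ∘
            ⇑(Equiv.sumCongr (eQ.prodCongr (Equiv.refl (Fin T))) (eC.prodCongr (Equiv.refl (Fin T)))))
        p q := by
  unfold phenomFailureProb
  refine Finset.sum_nbij'
    (fun E' => E' ∘ ⇑(Equiv.sumCongr (eQ.prodCongr (Equiv.refl (Fin T))) (eC.prodCongr (Equiv.refl (Fin T)))))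
    (fun E => E ∘ ⇑(Equiv.sumCongr (eQ.prodCongr (Equiv.refl (Fin T))) (eC.prodCongr (Equiv.refl (Fin T)))).symm)
    ?_ ?_ ?_ ?_ ?_
  · intro E' hE'
    rw [mem_filter] at hE' ⊢
    exact ⟨mem_univ _, fun hc => hE'.2 ((corrects_pullback_iff H eC eQ hS D' E').1 hc)⟩
  · intro E hE
    rw [mem_filter] at hE ⊢
    refine ⟨mem_univ _, fun hc => hE.2 ?_⟩
    have h' := (corrects_pullback_iff H eC eQ hS D'
      (E ∘ ⇑(Equiv.sumCongr (eQ.prodCongr (Equiv.refl (Fin T))) (eC.prodCongr (Equiv.refl (Fin T)))).symm)).2 hc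
    have hcomp : (E ∘ ⇑(Equiv.sumCongr (eQ.prodCongr (Equiv.refl (Fin T))) (eC.prodCongr (Equiv.refl (Fin T)))).symm) ∘
        ⇑(Equiv.sumCongr (eQ.prodCongr (Equiv.refl (Fin T))) (eC.prodCongr (Equiv.refl (Fin T)))) = E := by
      funext ℓ
      simp only [Function.comp_apply, Equiv.symm_apply_apply]
    rwa [hcomp] at h'
  · intro E' _
    funext ℓ
    simp only [Function.comp_apply, Equiv.apply_symm_apply]
  · intro E _
    funext ℓ
    simp only [Function.comp_apply, Equiv.symm_apply_apply]
  · intro E' _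
    exact (phenomenologicalWeight_comp_locEquiv eC eQ E' p q).symm

end CSSPhenom

end Literature.InformationTheory.QuantumCodes
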